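import Summits.BirchSwinnertonDyer.BirchSwinnertonDyer.Theorems.EisensteinPrimesWeakLeopoldtAboveOfSqueeze
import Summits.BirchSwinnertonDyer.BirchSwinnertonDyer.Theorems.EisensteinPrimesAcTwistDeformationSurAtVbar
import HarnessLib

/-!
# WL_ω / WL_1 IN THE CRUX'S BINDERS: `H²(Gal(K_Σ/K_∞), (F/𝒪)(θ)) = 0` for `θ ∈ {θsub, θquot}` of the residual pair,
# from [RH] and the published corank formulas, for EVERY descent of `(F/𝒪)(θ)` to `G_{K,Σ}`
# (cell `bsd-eis`, seat `bsd-line-x1-p1-w2` gen 4; crux 2 `GoodLatticeBDPValue` stmt-BirchSwinnertonDyer-19032, line `halves`,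
# V21 road input WL_A for the two characters)

HONEST FRAMING (cell `bsd-eis`, run/shared/lean/pub/bsd-eis/): theorems only (no definition, no named fact, no `sorry`, no
`Theses` import); the PUBLISHED facts Greenberg 2006 Props. 4.1, 4.2, §5 A, 3.2 and `cd_p(G_{K,Σ}) ≤ 2` (Harari Cor. 17.14 /
NSW (8.3.18)) and the [RH] cotorsion clause (Keller–Yin Thm. 1.2.2 / Rubin–Hida, the binder `hSsub`/`hSquot` of the crux's
consumers at `Sf = ∅`) enter as HYPOTHESES by name; nothing about any curve's BSD / IMC is asserted; BSD / IMC2 / KY Thm.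
1.4.1 are proved for NO curve here. Helper `--supports stmt-BirchSwinnertonDyer-19032`; closes no registered stub.

## What

This seat's #4 (`…WeakLeopoldtAboveOfSqueeze.subsingleton_H_two_above_of_squeeze_character`) gives weak Leopoldt above the
anticyclotomic `K_∞` for the twist deformation of ANY `A ≃ ℚ_p/ℤ_p` with scalar `G_{K,S}`-action, granted the `σ`-supply on
`S` and `corank_Λ S_{𝓛_v}(K, 𝐃₁) = 0`. w3 g3's S1 file (`…AcTwistDeformationSurAtVbar` §2) already DISCHARGED exactly these
two inputs at Keller–Yin's characters: the model `ρ_θ = characterRepUnramified S θ h` on `ℚ_p/ℤ_p` (`θ` unramified outside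
`S = {v, v̄} ∪ Sf` by Néron–Ogg–Shafarevich, `ramificationSubgroup_le_ker_unitChar_of_residualPair`), the `σ`-supply
(`exists_local_apply_ne_one_of_mem_insert_insert`: class field theory above `p`, Brink at `Sf`), and
`corank_Λ S_{𝓛_v} = 0` from [RH] through the Shapiro descent (`hasCorank_fullAtSelmer_zero_of_RH`). THIS FILE composes them:

* **`subsingleton_H_two_above_characterRep_of_RH`** — at the model: `H²(Gal(K_Σ/K_∞), ℚ_p/ℤ_p(θ)) = 0`
  (`Σ = {v, v̄} ∪ Sf`, `θ ∈ {θsub, θquot}`), GRANTED h41/h42/h5A/h32/hCD2 by name and [RH] for `θ`.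
* **`subsingleton_H_two_above_charModule_of_RH`** — the same for EVERY continuous representation `ρM` of `G_{K,Σ}` on Keller–Yin's
  module `charModule ∅ θ = (F/𝒪)(θ)` itself (any coefficient ring `R`, any discrete topology instance) that DESCENDS the
  `Γ_K`-action (`ρM (toUnramifiedQuot K Σ σ) m = σ • m` — e.g. w4 g4's `exists_continuousRep_quot`):
  **`Subsingleton ((ρM.restrict (galoisGroupAboveSubtype Σ κ.kerSubgroup)).H 2)`** — transported along
  `ψ = (charModuleEquiv θ)⁻¹` (`charModuleEquiv_symm_galois`) by the currency bridge of #3 §4. With `θ = θsub` this is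
  WL_ω, with `θ = θquot` WL_1 of the V21 road (inputs of w4 g4's `H2Bookkeeping.natCard_H2bookkeeping_of_groupCdLE`).

References: [Greenberg2006] Thm. 3 p. 342, Props. 3.2–3.6, 4.1–4.2, §5 A; [Greenberg2016Selmer] §2.2–2.3, Prop. 2.6.3 setting;
[KellerYin2024] Thm. 1.2.2, Rem. 1.2.3 (ii), §1.4 (arXiv:2402.12781v2); [PollackWeston2011] App. A Prop. A.2;
[NeukirchSchmidtWingberg2008] (8.3.18); [Harari2020] Cor. 17.14; [Brink2007] Thm. 2; the road memo §3.
-/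

set_option autoImplicit false
set_option linter.dupNamespace false -- the summit namespace `…BirchSwinnertonDyer.BirchSwinnertonDyer.Theorems` (Sub = Summit, D-0017) trips it

noncomputable section

open scoped Classical
open NumberField IsDedekindDomain Field Multiplicative WeierstrassCurve
open Literature.NumberTheory.EllipticCurves Literature.NumberTheory.EllipticCurves.GreenbergSelmer
  Literature.NumberTheory.EllipticCurves.GreenbergVatsal2000 Literature.NumberTheory.GaloisRepresentations
  Literature.NumberTheory.GaloisCohomology
  Literature.NumberTheory.EllipticCurves.KellerYin2024 Literature.NumberTheory.EllipticCurves.IwasawaDual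
  Literature.NumberTheory.IwasawaTheory Literature.NumberTheory.IwasawaTheory.Greenberg2016
  Literature.NumberTheory.IwasawaTheory.Greenberg2006
  Summit.BirchSwinnertonDyer.BirchSwinnertonDyer.Theorems.GreenbergFullAtSelmer
  Summit.BirchSwinnertonDyer.BirchSwinnertonDyer.Theorems.AcTwistDeformationResidualPair
  Summit.BirchSwinnertonDyer.BirchSwinnertonDyer.Theorems.AcTwistDeformation
  Summit.BirchSwinnertonDyer.BirchSwinnertonDyer.Theorems.WeakLeopoldtAbove
  Summit.BirchSwinnertonDyer.BirchSwinnertonDyer.Theorems.WeakLeopoldtAboveOfSqueeze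

namespace Summit.BirchSwinnertonDyer.BirchSwinnertonDyer.Theorems.WeakLeopoldtAboveCharModule

variable {K : Type} [Field K] [NumberField K] {p : ℕ} [Fact p.Prime]

/-- **WL above `K_∞` for the MODEL `ℚ_p/ℤ_p(θ)` of a character unramified outside `Σ = {v, v̄} ∪ Sf`, from [RH] and the
published facts by name.** For `2 < p`, `K` imaginary quadratic with (Heeg) for `N`, `v ≠ v̄` above `p` (`v` through `ι`), `κ`
the anticyclotomic `ℤ_p`-extension with topological generator `γ`, `Sf` = the places over `N`, a character `θ : Γ_K → GL₁(𝒪)`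
with `N_Σ ≤ ker (unitChar θ)` (`h`; e.g. `θ ∈ {θsub, θquot}` of a residual pair, `ramificationSubgroup_le_ker_unitChar_of_residualPair`)
and [RH] (every `Λ`-dual of `H¹_{𝓕_nr}(K_∞, (F/𝒪)(θ))` finitely generated torsion, `μ = 0`):
`H²(Gal(K_Σ/K_∞), ℚ_p/ℤ_p(θ)) = 0` for the model `ρ_θ = characterRepUnramified Σ θ h` — GRANTED Greenberg 2006 Props. 4.1, 4.2,
§5 A, 3.2 and `cd_p(G_{K,Σ}) ≤ 2` BY NAME. (#4's `subsingleton_H_two_above_of_squeeze_character`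
with S1's discharges: `σ`-supply `exists_local_apply_ne_one_of_mem_insert_insert`, [RH]-transport `hasCorank_fullAtSelmer_zero_of_RH`.)
[cite: Greenberg2006, Thm. 3 p. 342, Props. 4.1–4.2 pp. 367–368, §5 A, Props. 3.2–3.6]
[cite: KellerYin2024, Thm. 1.2.2, Rem. 1.2.3 (ii) (arXiv:2402.12781v2 TeX L676–712)] [cite: NeukirchSchmidtWingberg2008, (8.3.18)] -/
theorem subsingleton_H_two_above_characterRep_of_RH (hCD2 : groupCdLE_two_galoisGroupUnramifiedOutside K)
    (h41 : prop41_globalEulerPoincareCorank) (h42 : prop42_localEulerPoincareCorank)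
    (h5A : sec5A_localH2_subsingleton_of_LOC1) (h32 : prop32_cohomology_isCofinitelyGenerated)
    (hp : 2 < p) (hK : IsImaginaryQuadratic K) {N : ℕ} (hH : SatisfiesHeegnerHypothesis N K)
    {ι : K →+* ℚ_[p]} {v vbar : HeightOneSpectrum (𝓞 K)}
    (hvι : ∀ x : 𝓞 K, x ∈ v.asIdeal ↔ ‖ι (x : K)‖ < 1)
    (hvbar : ((p : ℕ) : 𝓞 K) ∈ vbar.asIdeal) (hne : vbar ≠ v)
    (κ : ZpExtension K p) (hκ : κ.IsAnticyclotomic) (γ : absoluteGaloisGroup K) [Fact (κ.IsTopGenerator γ)]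
    (Sf : Finset (HeightOneSpectrum (𝓞 K)))
    (hSf : ∀ w : HeightOneSpectrum (𝓞 K), w ∈ Sf ↔ ((N : ℤ) : 𝓞 K) ∈ w.asIdeal)
    (θ : FramedGaloisRep K (padicCoeffIntegers (∅ : Set (PadicAlgCl p))) 1)
    (hRH : ∀ D : DatumDualData κ γ (charModule (∅ : Set (PadicAlgCl p)) θ)
        (Castella2018.AcSelmer.bdpData (charModule (∅ : Set (PadicAlgCl p)) θ) p vbar)
        (∅ : Set (HeightOneSpectrum (𝓞 K))),
      Module.Finite (IwasawaAlgebra p) D.X ∧ Module.IsTorsion (IwasawaAlgebra p) D.X ∧ muInvariant p D.X = 0)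
    (hS : ∀ w : HeightOneSpectrum (𝓞 K), ((p : ℕ) : 𝓞 K) ∈ w.asIdeal →
      w ∈ (↑(insert v (insert vbar Sf)) : Set (HeightOneSpectrum (𝓞 K))))
    (h : ramificationSubgroup K (↑(insert v (insert vbar Sf)) : Set (HeightOneSpectrum (𝓞 K))) ≤
      (unitChar θ).toMonoidHom.ker)
    [DiscreteTopology (QpModZp p)] [ContinuousSMul ℤ_[p] (QpModZp p)] :
    Subsingleton (((characterRepUnramified _ θ h).restrict
      (galoisGroupAboveSubtype (↑(insert v (insert vbar Sf)) : Set (HeightOneSpectrum (𝓞 K))) κ.kerSubgroup)).H 2) := by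
  have hγ : κ.IsTopGenerator γ := Fact.out
  have hv : ((p : ℕ) : 𝓞 K) ∈ v.asIdeal := IwasawaTwoVariable.natCast_mem_asIdeal_of_norm_iff hvι
  -- the canonical (discrete) topological instances of the twist-deformation model
  letI tΛ : TopologicalSpace (PowerSeries ℤ_[p]) := ⊥
  haveI : DiscreteTopology (PowerSeries ℤ_[p]) := ⟨rfl⟩
  haveI : IsTopologicalRing (PowerSeries ℤ_[p]) := inferInstance
  haveI : IsTopologicalAddGroup (BigRepModule ℤ_[p] p (QpModZp p)) := inferInstance
  haveI : ContinuousSMul (PowerSeries ℤ_[p]) (BigRepModule ℤ_[p] p (QpModZp p)) := inferInstance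
  -- [RH] ⇒ `corank_Λ S_{𝓛_v}(K, 𝐃₁(θ)) = 0`; the `σ`-supply on `Σ`
  obtain ⟨hSel, -⟩ := hasCorank_fullAtSelmer_zero_of_RH hK κ hγ hv hvbar hne θ _ hS h hRH
  exact subsingleton_H_two_above_of_squeeze_character hS κ (characterRepUnramified _ θ h) hCD2 h41 h42 h5A h32 hp.ne'
    (Finset.finite_toSet _) hK (LinearEquiv.refl ℤ_[p] (QpModZp p)) (characterRepUnramified_hscalar _ θ h)
    (exists_local_apply_ne_one_of_mem_insert_insert hK hp hH κ hκ hv hvbar Sf hSf) hne hv hvbar hSel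

/-- **WL_ω / WL_1 IN THE CRUX'S BINDERS, for EVERY descent of `(F/𝒪)(θ)` to `G_{K,Σ}`.** Same data as
`subsingleton_H_two_above_characterRep_of_RH` (`θ ∈ {θsub, θquot}`, [RH] for `θ`, the five PUB facts by name); then for every
continuous representation `ρM` of `G_{K,Σ}`, `Σ = {v, v̄} ∪ Sf`, over ANY coefficient ring `R`, on Keller–Yin's module
`charModule ∅ θ = (F/𝒪)(θ)` (any discrete topology) which DESCENDS the `Γ_K`-action — `ρM (toUnramifiedQuot K Σ σ) m = σ • m` —
**`H²(Gal(K_Σ/K_∞), (F/𝒪)(θ)) = 0`**: `Subsingleton ((ρM.restrict (galoisGroupAboveSubtype Σ κ.kerSubgroup)).H 2)`. Transport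
from the model along `ψ = (charModuleEquiv θ)⁻¹` (`charModuleEquiv_symm_galois`; the bridge
`WeakLeopoldtAbove.subsingleton_H_restrict_iff_of_continuousAddEquiv`). [cite: Greenberg2006, Thm. 3 p. 342, Props. 4.1–4.2, §5 A, 3.2]
[cite: KellerYin2024, §1.1 (TeX L441–449), Thm. 1.2.2, §1.4 (L1183–1330)] [cite: NeukirchSchmidtWingberg2008, (8.3.18)] -/
theorem subsingleton_H_two_above_charModule_of_RH (hCD2 : groupCdLE_two_galoisGroupUnramifiedOutside K)
    (h41 : prop41_globalEulerPoincareCorank) (h42 : prop42_localEulerPoincareCorank)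
    (h5A : sec5A_localH2_subsingleton_of_LOC1) (h32 : prop32_cohomology_isCofinitelyGenerated)
    (W : WeierstrassCurve ℚ) [W.IsElliptic] (hp : 2 < p) (hK : IsImaginaryQuadratic K)
    (hH : SatisfiesHeegnerHypothesis (W.conductorNorm ℤ) K)
    {ι : K →+* ℚ_[p]} {v vbar : HeightOneSpectrum (𝓞 K)}
    (hvι : ∀ x : 𝓞 K, x ∈ v.asIdeal ↔ ‖ι (x : K)‖ < 1)
    (hvbar : ((p : ℕ) : 𝓞 K) ∈ vbar.asIdeal) (hne : vbar ≠ v)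
    (κ : ZpExtension K p) (hκ : κ.IsAnticyclotomic) (γ : absoluteGaloisGroup K) [Fact (κ.IsTopGenerator γ)]
    {θsub θquot : FramedGaloisRep K (padicCoeffIntegers (∅ : Set (PadicAlgCl p))) 1}
    (hpair : IsResidualPairOver (W.baseChange K) p θsub θquot)
    (Sf : Finset (HeightOneSpectrum (𝓞 K)))
    (hSf : ∀ w : HeightOneSpectrum (𝓞 K), w ∈ Sf ↔ ((W.conductorNorm ℤ : ℤ) : 𝓞 K) ∈ w.asIdeal)
    (θ : FramedGaloisRep K (padicCoeffIntegers (∅ : Set (PadicAlgCl p))) 1) (hθ : θ = θsub ∨ θ = θquot)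
    (hRH : ∀ D : DatumDualData κ γ (charModule (∅ : Set (PadicAlgCl p)) θ)
        (Castella2018.AcSelmer.bdpData (charModule (∅ : Set (PadicAlgCl p)) θ) p vbar)
        (∅ : Set (HeightOneSpectrum (𝓞 K))),
      Module.Finite (IwasawaAlgebra p) D.X ∧ Module.IsTorsion (IwasawaAlgebra p) D.X ∧ muInvariant p D.X = 0)
    [TopologicalSpace (charModule (∅ : Set (PadicAlgCl p)) θ)] [DiscreteTopology (charModule (∅ : Set (PadicAlgCl p)) θ)]
    {R : Type} [CommRing R] [TopologicalSpace R] [Module R (charModule (∅ : Set (PadicAlgCl p)) θ)]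
    [ContinuousSMul R (charModule (∅ : Set (PadicAlgCl p)) θ)]
    (ρM : ContinuousRep (GaloisGroupUnramifiedOutside K (↑(insert v (insert vbar Sf)) : Set (HeightOneSpectrum (𝓞 K))))
      R (charModule (∅ : Set (PadicAlgCl p)) θ))
    (hρM : ∀ (σ : absoluteGaloisGroup K) (m : charModule (∅ : Set (PadicAlgCl p)) θ),
      ρM (toUnramifiedQuot K _ σ) m = σ • m) :
    Subsingleton ((ρM.restrict
      (galoisGroupAboveSubtype (↑(insert v (insert vbar Sf)) : Set (HeightOneSpectrum (𝓞 K))) κ.kerSubgroup)).H 2) := by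
  have hv : ((p : ℕ) : 𝓞 K) ∈ v.asIdeal := IwasawaTwoVariable.natCast_mem_asIdeal_of_norm_iff hvι
  -- `Σ = {v, v̄} ∪ Sf ⊇ S_p`; `θ` is unramified outside `Σ`
  have hS : ∀ w : HeightOneSpectrum (𝓞 K), ((p : ℕ) : 𝓞 K) ∈ w.asIdeal →
      w ∈ (↑(insert v (insert vbar Sf)) : Set (HeightOneSpectrum (𝓞 K))) :=
    mem_insert_insert_of_natCast_mem hK hv hvbar hne Sf
  have hSfS : ∀ w ∈ Sf, w ∈ (↑(insert v (insert vbar Sf)) : Set (HeightOneSpectrum (𝓞 K))) := fun w hw ↦ by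
    rw [Finset.coe_insert, Finset.coe_insert]
    exact Or.inr (Or.inr (Finset.mem_coe.mpr hw))
  have h : ramificationSubgroup K (↑(insert v (insert vbar Sf)) : Set (HeightOneSpectrum (𝓞 K))) ≤
      (unitChar θ).toMonoidHom.ker :=
    ramificationSubgroup_le_ker_unitChar_of_residualPair W hpair Sf hSf _ hSfS hS θ hθ
  -- the model `ℚ_p/ℤ_p(θ)`, discrete
  haveI hAdisc : DiscreteTopology (QpModZp p) := QpModZp.discreteTopology p
  haveI : ContinuousSMul ℤ_[p] (QpModZp p) := QpModZp.continuousSMul p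
  have hA := subsingleton_H_two_above_characterRep_of_RH hCD2 h41 h42 h5A h32 hp hK hH hvι hvbar hne κ hκ γ Sf hSf θ
    hRH hS h
  -- transport along `ψ = (charModuleEquiv θ)⁻¹ : ℚ_p/ℤ_p(θ) ≃ (F/𝒪)(θ)` (equivariant, both discrete)
  let η : QpModZp p ≃ₜ+ charModule (∅ : Set (PadicAlgCl p)) θ :=
    { (charModuleEquiv θ).symm with
      continuous_toFun := continuous_of_discreteTopology
      continuous_invFun := continuous_of_discreteTopology }
  have hη : ∀ (g : GaloisGroupUnramifiedOutside K (↑(insert v (insert vbar Sf)) : Set (HeightOneSpectrum (𝓞 K))))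
      (a : QpModZp p), η (characterRepUnramified _ θ h g a) = ρM g (η a) := fun g a ↦ by
    obtain ⟨σ, rfl⟩ := toUnramifiedQuot_surjective K _ g
    change (charModuleEquiv θ).symm _ = ρM _ ((charModuleEquiv θ).symm a)
    rw [charModuleEquiv_symm_galois, hρM]
  exact (subsingleton_H_restrict_iff_of_continuousAddEquiv (characterRepUnramified _ θ h) ρM η hη _ 2).mp hA

end Summit.BirchSwinnertonDyer.BirchSwinnertonDyer.Theorems.WeakLeopoldtAboveCharModule

end
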